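import Summits.KontsevichZagierPeriods.KontsevichZagierPeriods.Theorems.EllipticMomentKernel.Negative.GeneralCurve
import Mathlib.MeasureTheory.Function.JacobianOneDim

/-!
# `EllipticMomentKernel` (stmt-KontsevichZagierPeriods-10631) — negative knowledge, part 13:
# the rigidity hypothesis is a twist invariant

For `l > 0` real ALGEBRAIC, the normal-form values of the elliptic moment sector transform under
the twist `(q₂, q₃) ↦ (l²q₂, l³q₃)` (change of variables `x = l·u`, which maps the oval
`(e₃, e₂)` onto `(le₃, le₂)` and `f` to `l³·f`) with weights `∓1/2`:
`J0_twist : J₀(l²q₂, l³q₃) = J₀(q₂,q₃)/√l`, `J1_twist : J₁(l²q₂, l³q₃) = √l·J₁(q₂,q₃)`. Hence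
`rigid_twist : Rigid q₂ q₃ → Rigid (l²q₂) (l³q₃)` — the crux's inlined hypothesis "`1, J₀, J₁`
linearly independent over the real algebraic numbers" depends only on the `ℚ̄`-twist class of the
curve (as Masser's theorem predicts), and ONE instance proved in Lean seeds its whole rational
twist family; e.g. `rigid_q2_zero_of_rigid_four_zero : Rigid 4 0 → 0 < q₂ → Rigid q₂ 0` (the
`j = 1728` family; `Rigid 4 0` itself is part 12 + route Grothendieck's `keAlgIndependent_proof`).
Standing-adversary findings of cdisprove cycle 3 (`Cruxes/EllipticMomentKernel/Disproof.lean`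
§12). This file declares no definitions. [Kontsevich–Zagier 2001, §1.2; Masser 1975, Ch. II]
-/

noncomputable section

open MeasureTheory Set

namespace Summit.KontsevichZagierPeriods.HermiteRigidity.EllipticMomentKernelNegative

open Literature.NumberTheory.Transcendental
open Literature.NumberTheory.Transcendental.KZ

/-! ### Rigidity is a twist invariant: `(q₂, q₃) ↦ (l²q₂, l³q₃)`, `l > 0` real algebraic -/

section TwistGeneral

variable {q₂ q₃ q₂' q₃' : ℚ} {l : ℝ}

/-- The twisted cubic: `f_{l²q₂, l³q₃}(l·u) = l³·f_{q₂,q₃}(u)`. [folklore] -/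
theorem cubic_twist (h2 : (q₂' : ℝ) = l ^ 2 * q₂) (h3 : (q₃' : ℝ) = l ^ 3 * q₃) (u : ℝ) :
    cubic q₂' q₃' (l * u) = l ^ 3 * cubic q₂ q₃ u := by
  simp only [cubic, h2, h3]
  ring

/-- The twisted cubic factors over the scaled roots. [folklore] -/
theorem cubic_twist_roots (hl0 : 0 < l) (h2 : (q₂' : ℝ) = l ^ 2 * q₂) (h3 : (q₃' : ℝ) = l ^ 3 * q₃)
    {e₃ e₂ e₁ : ℝ} (hf : ∀ x, cubic q₂ q₃ x = 4 * (x - e₃) * (x - e₂) * (x - e₁)) (x : ℝ) :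
    cubic q₂' q₃' x = 4 * (x - l * e₃) * (x - l * e₂) * (x - l * e₁) := by
  have hx : x = l * (x / l) := by field_simp
  rw [hx, cubic_twist h2 h3, hf]
  field_simp

/-- Transfer of an integral over an oval known to be an interval `(a, b)`. [folklore] -/
theorem setIntegral_oval_of_eq {a b : ℝ} (hσ : oval q₂ q₃ = {p | p 0 ∈ Ioo a b}) (g : ℝ → ℝ) :
    ∫ p in oval q₂ q₃, g (p 0) = ∫ x in Ioo a b, g x := by
  have key := measurePreserving_e1.setIntegral_preimage_emb e1.measurableEmbedding g (Ioo a b)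
  simp only [e1_apply] at key
  rw [hσ, show {p : Fin 1 → ℝ | p 0 ∈ Ioo a b} = e1 ⁻¹' Ioo a b from rfl]
  exact key

/-- Change of variables `x = l·u`, `(a,b) → (la, lb)` (`l > 0`). [folklore] -/
theorem integral_Ioo_comp_mul_left_of_pos (hl0 : 0 < l) (a b : ℝ) (g : ℝ → ℝ) :
    ∫ x in Ioo (l * a) (l * b), g x = ∫ u in Ioo a b, l * g (l * u) := by
  have himage : (fun u : ℝ => l * u) '' Ioo a b = Ioo (l * a) (l * b) := by
    ext x
    constructor
    · rintro ⟨u, hu, rfl⟩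
      exact ⟨mul_lt_mul_of_pos_left hu.1 hl0, mul_lt_mul_of_pos_left hu.2 hl0⟩
    · intro hx
      refine ⟨x / l, ⟨?_, ?_⟩, ?_⟩
      · rw [lt_div_iff₀ hl0]; linarith [hx.1]
      · rw [div_lt_iff₀ hl0]; linarith [hx.2]
      · simp only; field_simp
  have hderiv : ∀ u ∈ Ioo a b, HasDerivWithinAt (fun u : ℝ => l * u) l (Ioo a b) u := by
    intro u _
    simpa using ((hasDerivAt_id u).const_mul l).hasDerivWithinAt
  have hinj : InjOn (fun u : ℝ => l * u) (Ioo a b) := by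
    intro x _ y _ hxy
    exact mul_left_cancel₀ hl0.ne' hxy
  have key := integral_image_eq_integral_abs_deriv_smul measurableSet_Ioo hderiv hinj g
  rw [himage] at key
  rw [key]
  refine setIntegral_congr_fun measurableSet_Ioo (fun u _ => ?_)
  rw [smul_eq_mul, abs_of_pos hl0]

/-- `√(l³·f) = l·(√l·√f)` for `l ≥ 0`. [folklore] -/
theorem sqrt_cube_mul {l y : ℝ} (hl : 0 ≤ l) :
    Real.sqrt (l ^ 3 * y) = l * (Real.sqrt l * Real.sqrt y) := by
  rw [show l ^ 3 * y = l ^ 2 * (l * y) by ring, Real.sqrt_mul (sq_nonneg l), Real.sqrt_sq hl,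
    Real.sqrt_mul hl]

/-- **`J₀` has weight `−1/2` under twisting**: `J₀(l²q₂, l³q₃) = J₀(q₂, q₃)/√l`. [folklore] -/
theorem J0_twist (hd : 0 < disc q₂ q₃) (hl0 : 0 < l) (h2 : (q₂' : ℝ) = l ^ 2 * q₂)
    (h3 : (q₃' : ℝ) = l ^ 3 * q₃) : J0 q₂' q₃' = (Real.sqrt l)⁻¹ * J0 q₂ q₃ := by
  obtain ⟨e₃, e₂, e₁, he3, he2a, he2b, he1, hf⟩ := exists_roots hd
  have h32 : e₃ < e₂ := by linarith
  have h21 : e₂ < e₁ := by linarith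
  have hσ := oval_eq_of_roots h32 h21 hf
  have hσ' := oval_eq_of_roots (mul_lt_mul_of_pos_left h32 hl0) (mul_lt_mul_of_pos_left h21 hl0)
    (cubic_twist_roots hl0 h2 h3 hf)
  have h1 := setIntegral_oval_of_eq hσ' (fun x => 1 / Real.sqrt (cubic q₂' q₃' x))
  have h4 := setIntegral_oval_of_eq hσ (fun x => 1 / Real.sqrt (cubic q₂ q₃ x))
  unfold J0
  rw [h1, h4, integral_Ioo_comp_mul_left_of_pos hl0, ← integral_const_mul]
  refine setIntegral_congr_fun measurableSet_Ioo (fun u hu => ?_)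
  rw [cubic_twist h2 h3 u, sqrt_cube_mul hl0.le]
  have hsl : 0 < Real.sqrt l := Real.sqrt_pos.mpr hl0
  have hsf : 0 < Real.sqrt (cubic q₂ q₃ u) :=
    Real.sqrt_pos.mpr ((cubic_sign_of_roots h32 h21 hf).1 u hu)
  field_simp

/-- **`J₁` has weight `+1/2` under twisting**: `J₁(l²q₂, l³q₃) = √l·J₁(q₂, q₃)`. [folklore] -/
theorem J1_twist (hd : 0 < disc q₂ q₃) (hl0 : 0 < l) (h2 : (q₂' : ℝ) = l ^ 2 * q₂)
    (h3 : (q₃' : ℝ) = l ^ 3 * q₃) : J1 q₂' q₃' = Real.sqrt l * J1 q₂ q₃ := by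
  obtain ⟨e₃, e₂, e₁, he3, he2a, he2b, he1, hf⟩ := exists_roots hd
  have h32 : e₃ < e₂ := by linarith
  have h21 : e₂ < e₁ := by linarith
  have hσ := oval_eq_of_roots h32 h21 hf
  have hσ' := oval_eq_of_roots (mul_lt_mul_of_pos_left h32 hl0) (mul_lt_mul_of_pos_left h21 hl0)
    (cubic_twist_roots hl0 h2 h3 hf)
  have h1 := setIntegral_oval_of_eq hσ' (fun x => x / Real.sqrt (cubic q₂' q₃' x))
  have h4 := setIntegral_oval_of_eq hσ (fun x => x / Real.sqrt (cubic q₂ q₃ x))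
  unfold J1
  rw [h1, h4, integral_Ioo_comp_mul_left_of_pos hl0, ← integral_const_mul]
  refine setIntegral_congr_fun measurableSet_Ioo (fun u hu => ?_)
  rw [cubic_twist h2 h3 u, sqrt_cube_mul hl0.le]
  have hsl : 0 < Real.sqrt l := Real.sqrt_pos.mpr hl0
  have hsf : 0 < Real.sqrt (cubic q₂ q₃ u) :=
    Real.sqrt_pos.mpr ((cubic_sign_of_roots h32 h21 hf).1 u hu)
  have hll : Real.sqrt l ^ 2 = l := Real.sq_sqrt hl0.le
  field_simp
  linear_combination (-u) * hll

/-- **RIGIDITY IS A TWIST INVARIANT**: if `1, J₀, J₁` are linearly independent over the real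
algebraic numbers on `y² = 4x³ − q₂x − q₃`, then so they are on every twist
`y² = 4x³ − l²q₂x − l³q₃` with `l > 0` real ALGEBRAIC — `(a, b, c) ↦ (a, b/√l, c·√l)`. In
particular `Rigid` depends only on the `ℚ̄`-isomorphism class of the curve, as Masser's theorem
predicts; and ONE proved instance seeds a whole rational twist family. [folklore] -/
theorem rigid_twist (hR : Rigid q₂ q₃) (hl0 : 0 < l) (hla : IsAlgebraic ℚ l)
    (h2 : (q₂' : ℝ) = l ^ 2 * q₂) (h3 : (q₃' : ℝ) = l ^ 3 * q₃) : Rigid q₂' q₃' := by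
  have hd : 0 < disc q₂ q₃ := disc_pos_of_rigid hR
  have hsl2 : IsAlgebraic ℚ (Real.sqrt l ^ 2) := by
    rw [Real.sq_sqrt hl0.le]
    exact hla
  have hsl_alg : IsAlgebraic ℚ (Real.sqrt l) := hsl2.of_pow two_pos
  have hsl : Real.sqrt l ≠ 0 := (Real.sqrt_pos.mpr hl0).ne'
  intro a b c ha hb hc h
  rw [J0_twist hd hl0 h2 h3, J1_twist hd hl0 h2 h3] at h
  obtain ⟨ha0, hb0, hc0⟩ := hR a (b * (Real.sqrt l)⁻¹) (c * Real.sqrt l) ha (hb.mul hsl_alg.inv)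
    (hc.mul hsl_alg) (by linear_combination h)
  refine ⟨ha0, ?_, ?_⟩
  · rcases mul_eq_zero.mp hb0 with h0 | h0
    · exact h0
    · exact absurd h0 (inv_ne_zero hsl)
  · rcases mul_eq_zero.mp hc0 with h0 | h0
    · exact h0
    · exact absurd h0 hsl

/-- **The `j = 1728` family**: `Rigid 4 0 → Rigid q₂ 0` for every rational `q₂ > 0`
(`l = √q₂/2`, `l²·4 = q₂`, `l³·0 = 0`). [folklore] -/
theorem rigid_q2_zero_of_rigid_four_zero (h4 : Rigid 4 0) {q₂ : ℚ} (hq : 0 < q₂) : Rigid q₂ 0 := by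
  have hq' : (0 : ℝ) < q₂ := by exact_mod_cast hq
  have hl0 : 0 < Real.sqrt q₂ / 2 := by positivity
  have hl2 : (Real.sqrt q₂ / 2) ^ 2 = ((q₂ / 4 : ℚ) : ℝ) := by
    push_cast
    rw [div_pow, Real.sq_sqrt hq'.le]
    ring
  have hla : IsAlgebraic ℚ (Real.sqrt q₂ / 2) :=
    (show IsAlgebraic ℚ ((Real.sqrt q₂ / 2) ^ 2) by rw [hl2]; exact isAlgebraic_algebraMap _).of_pow
      two_pos
  refine rigid_twist h4 hl0 hla ?_ ?_
  · push_cast at hl2 ⊢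
    linarith
  · push_cast
    ring

/-- `disc q₂ 0 = q₂³ > 0`. [folklore] -/
theorem disc_q2_zero_pos {q₂ : ℚ} (hq : 0 < q₂) : 0 < disc q₂ 0 := by
  have hq' : (0 : ℝ) < q₂ := by exact_mod_cast hq
  simp only [disc]
  push_cast
  nlinarith [pow_pos hq' 3]


end TwistGeneral


end Summit.KontsevichZagierPeriods.HermiteRigidity.EllipticMomentKernelNegative

end
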